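import Summits.AtomisticToContinuum.FouriersLaw.Theorems.PhononMeanFreePathIncoherentChannelLightCone

/-!
# Stub `lightCone_rate_of_sq_le` of line `two-horizons-forecast-loss` (crux `PhononMeanFreePath.IncoherentChannel`)

Registered stub `lightCone_rate_of_sq_le` of the lead's skeleton of crux stmt-AtomisticToContinuum-11811
(`Summit.AtomisticToContinuum.FouriersLaw.Theses.PhononMeanFreePath.IncoherentChannel`), proved with
exactly the registered signature. It is the ABSTRACT two-regime real analysis of a Gibbs-mean light cone
(pure real analysis, no chain objects): a family `X_N(t)` with, for every `k`,
`X_N(t)² ≤ K₂·(4A·e^Λ Λ^N/N! + C_k t^{2^k} √(N+1)/Λ^{2^k})` for all `Λ > 0`, `t ≥ 0`,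
is super-polynomially small in the window `0 ≤ t ≤ N^η` (`0 < η < 1`): there is `ε_N` with
`N^{1+η} ε_N → 0` and `|X_N(t)| ≤ ε_N` there.

**Proof.** Choose `Λ = (N+1)/8` and `k` with `2^k ≥ 5/(1-η)`; then on the window the bracket is
`≤ B_N := 32A ρ^{N+1} + C 8^{2^k} (N+1)^{-s}` with `ρ = e^{9/8}/8 < 1` (`lightCone_inCone_le`,
`x^n/n! ≤ eˣ`) and `s = 2^k(1-η) - 1/2 > 4` (`lightCone_outCone_le`), and `ε_N := √(K₂ B_N)` works:
`|X| = √(X²) ≤ √(K₂ B_N)` and `N^{1+η} ε_N = √(K₂ N^{2+2η} B_N) → 0`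
(`lightCone_tendsto_rpow_mul_geom`, `lightCone_tendsto_rpow_mul_rpow_neg`). This is exactly the real
analysis inside the landed proof of `stub_lightCone`, with `T ↦ A` and the reduction constant folded
into `K₂`.
-/

noncomputable section

namespace Summit.AtomisticToContinuum.FouriersLaw.Theorems.PhononMeanFreePath

open MeasureTheory Set Filter Topology

/-- **Stub `lightCone_rate_of_sq_le`** — the two-regime real analysis of a Gibbs-mean light cone,
abstractly: a family `X_N(t)` with `X_N(t)² ≤ K₂·(4A e^Λ Λ^N/N! + C_k t^{2^k}√(N+1)/Λ^{2^k})` for all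
`Λ > 0` and every `k` is super-polynomially small in the window `t ≤ N^η`, `η < 1`: there is `ε_N` with
`N^{1+η} ε_N → 0` and `|X_N(t)| ≤ ε_N` for `0 ≤ t ≤ N^η` (`Λ = (N+1)/8`, `2^k ≥ 5/(1−η)`,
`ε_N = √(K₂ B_N)`, `B_N = 32A ρ^{N+1} + C 8^{2^k} (N+1)^{-(2^k(1-η) - 1/2)}`, `ρ = e^{9/8}/8`, as in the
proof of `stub_lightCone`). [folklore] -/
theorem lightCone_rate_of_sq_le {X : ℕ → ℝ → ℝ} {K₂ A : ℝ} (hK : 0 ≤ K₂) (hA : 0 ≤ A)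
    (hX : ∀ k : ℕ, ∃ C : ℝ, 0 ≤ C ∧ ∀ (N : ℕ) (t : ℝ), 0 ≤ t → ∀ Λ : ℝ, 0 < Λ →
      (X N t) ^ 2 ≤ K₂ * (4 * A * (Real.exp Λ * Λ ^ N / N.factorial) + C * t ^ (2 ^ k) * Real.sqrt (N + 1) / Λ ^ (2 ^ k)))
    {η : ℝ} (hη : 0 < η) (hη1 : η < 1) :
    ∃ ε : ℕ → ℝ, Tendsto (fun N : ℕ => (N : ℝ) ^ (1 + η) * ε N) atTop (𝓝 0) ∧
      ∀ (N : ℕ) (t : ℝ), 0 ≤ t → t ≤ (N : ℝ) ^ η → |X N t| ≤ ε N := by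
  -- the power `M = 2^k ≥ 5/(1-η)`
  obtain ⟨k, hk⟩ : ∃ k : ℕ, 5 / (1 - η) ≤ (2 : ℝ) ^ k := by
    obtain ⟨n, hn⟩ := exists_nat_ge (5 / (1 - η))
    refine ⟨n, hn.trans ?_⟩
    exact_mod_cast (Nat.lt_two_pow_self).le
  obtain ⟨C, hC0, hC⟩ := hX k
  set M : ℕ := 2 ^ k with hMdef
  have hMη : 5 ≤ (M : ℝ) * (1 - η) := by
    have h1η : 0 < 1 - η := by linarith
    have : (5 : ℝ) / (1 - η) * (1 - η) = 5 := by field_simp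
    have hM : ((M : ℕ) : ℝ) = (2 : ℝ) ^ k := by rw [hMdef]; push_cast; ring
    rw [hM]
    nlinarith
  -- the bound sequence
  set ρ : ℝ := Real.exp (9 / 8) / 8 with hρ
  have hρ0 : 0 ≤ ρ := by positivity
  have hρ1 : ρ < 1 := by rw [hρ, div_lt_one (by norm_num)]; exact lightCone_exp_nine_eighths_lt
  set s : ℝ := (M : ℝ) * (1 - η) - 1 / 2 with hs
  have hs_exp : η * M + 1 / 2 - M = -s := by rw [hs]; ring
  set B : ℕ → ℝ := fun N => 32 * A * ρ ^ (N + 1) + C * 8 ^ M * ((N : ℝ) + 1) ^ (-s) with hB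
  have hB0 : ∀ N, 0 ≤ B N := fun N => by positivity
  -- `X_N(t)² ≤ K₂ B_N` inside the window
  have hXB : ∀ (N : ℕ) (t : ℝ), 0 ≤ t → t ≤ (N : ℝ) ^ η → (X N t) ^ 2 ≤ K₂ * B N := by
    intro N t ht htN
    have hΛ : (0 : ℝ) < ((N : ℝ) + 1) / 8 := by positivity
    refine (hC N t ht _ hΛ).trans (mul_le_mul_of_nonneg_left ?_ hK)
    have h1 : 4 * A * (Real.exp (((N : ℝ) + 1) / 8) * (((N : ℝ) + 1) / 8) ^ N / N.factorial) ≤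
        32 * A * ρ ^ (N + 1) := by
      have := mul_le_mul_of_nonneg_left (lightCone_inCone_le N) (by positivity : (0 : ℝ) ≤ 4 * A)
      rw [hρ]; linarith
    have h2 := lightCone_outCone_le hC0 hη.le N M ht htN
    rw [hs_exp] at h2
    exact add_le_add h1 h2
  -- `ε_N = √(K₂ B_N)`
  refine ⟨fun N => Real.sqrt (K₂ * B N), ?_, fun N t ht htN => ?_⟩
  · -- `N^{1+η} ε_N → 0`
    have hs4 : 4 < s := by rw [hs]; linarith
    have hBt : Tendsto (fun N : ℕ => (N : ℝ) ^ (2 + 2 * η) * B N) atTop (𝓝 0) := by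
      have h1 := (lightCone_tendsto_rpow_mul_geom (by linarith : 0 ≤ 2 + 2 * η) (by linarith) hρ0 hρ1).const_mul
        (32 * A)
      have h2 := (lightCone_tendsto_rpow_mul_rpow_neg (by linarith : 0 ≤ 2 + 2 * η)
        (by linarith : 2 + 2 * η < s)).const_mul (C * 8 ^ M)
      have := h1.add h2
      simp only [mul_zero, add_zero] at this
      refine this.congr fun N => ?_
      simp only [hB]; ring
    have e1 : ∀ N : ℕ, (N : ℝ) ^ (1 + η) * Real.sqrt (K₂ * B N) =
        Real.sqrt ((N : ℝ) ^ (2 + 2 * η) * (K₂ * B N)) := by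
      intro N
      have hN0 : (0 : ℝ) ≤ N := Nat.cast_nonneg N
      have hsq : Real.sqrt ((N : ℝ) ^ (2 + 2 * η)) = (N : ℝ) ^ (1 + η) := by
        rw [Real.sqrt_eq_rpow, ← Real.rpow_mul hN0]
        congr 1; ring
      rw [Real.sqrt_mul (Real.rpow_nonneg hN0 _), hsq]
    have hT1 : Tendsto (fun N : ℕ => Real.sqrt ((N : ℝ) ^ (2 + 2 * η) * (K₂ * B N))) atTop (𝓝 0) := by
      have h := (hBt.const_mul K₂).sqrt
      rw [mul_zero, Real.sqrt_zero] at h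
      refine h.congr fun N => ?_
      congr 1; ring
    exact hT1.congr fun N => (e1 N).symm
  · -- the bound `|X_N(t)| = √(X_N(t)²) ≤ √(K₂ B_N)`
    rw [← Real.sqrt_sq_eq_abs]
    exact Real.sqrt_le_sqrt (hXB N t ht htN)

end Summit.AtomisticToContinuum.FouriersLaw.Theorems.PhononMeanFreePath

end
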